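import Literature.MathematicalPhysics.QuantumFieldTheory.Balaban1983to89.Node00.HistoryTermDatum214

/-!
# NODE 00 (YM-PLAN Track A) — W1 = [II] §2 (2.13)–(2.14), STOREY 9: THE TERM-INDEXED GENERATOR MADE TOTAL IN THE CUBE SIZE `M`
# (`W1.terms₀`, `W1.StepGen.ofTerms₀`, `W1.GenTower.ofTerms₀`, `W1.TermData214.Gn₀`; `= terms ∕ ofTerms ∕ Gn` under `[NeZero M]` by the faces
# `terms₀_eq` ∕ `ofTerms₀_eq` ∕ `GenTower.ofTerms₀_eq` ∕ `TermData214.Gn₀_eq`; empty index set and vanishing of everything generated at `M = 0`)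

NODE 00 DEFINER MODULE (seat `pub-ymgap-node00-def-W1`, generation 8, 2026-08-27).  APPEND-ONLY: a NEW importing module; g6's
`Node00/HistoryTermIndexedGenerator` (`TermLabel`, `TermFun`, `GenTermFun`, `StepGen.ofTerms`, `GenTower.ofTerms`, their faces and honesty lemmas), g7's
`Node00/HistoryTermDatum214` (`TermDatum214`, `TermData214.TF`, `TermData214.Gn`) and `B13Lemma3TorusTerms` (`terms`, `IsTerm`) untouched and CONSUMED BY
NAME.  [II] = [Balaban1988RG2Cluster] T. Bałaban, *Renormalization group approach to lattice gauge field theories. II. Cluster expansions*, Commun. Math.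
Phys. **116** (1988) 1–22; [I] = [Balaban1987RG1], part I, Commun. Math. Phys. **109** (1987) 249–301.

THE PIN (asked by name by the N22 consumer seat, 2026-08-27).  Print's term set `B13Lemma3TorusTerms.terms L M Z` — the pairs `(𝐃, P)` of (2.1), (2.3),
(2.9) localizing at `Z ∈ 𝐃_{k+1}` — is typed for a POSITIVE cube size `M` (`[NeZero M]`, the `M`-cubes of [II] p.12), and so are g6's term-indexed
generator `StepGen.ofTerms L T`, its tower `GenTower.ofTerms L T` and g7's generator tower of a term-datum family `TermData214.Gn`.  Every OTHER ingredient
of the W1 object is total in `M`: the domain systems `domSys P M j` (`domCount P M j = … + 1`), the one-step generators `StepGen P 𝔸 M k`, the towers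
`GenTower`, the generated terms `recTerm`, the real reading `toClusterTower`, the term labels `TermLabel`, the term functionals `TermFun` ∕ `GenTermFun`,
the (2.14) datum `TermDatum214` and its term functional `TermDatum214.TF`.  A Summit-side reading of record keyed by a parameter record `θ` whose cube
size `θ.M : ℕ` is a bare natural (positivity being one of the HYPOTHESES of the per-`θ` statement, not of the ambient signature) therefore cannot DEFINE
its generator tower as `GenTower.ofTerms L (TF θ)` outright; it had to carry a total tower `Gn θ` and an identification hypothesis `Gn θ = 𝔇.Gn` inside
the statement.  THIS STOREY MAKES THE TERM-INDEXED GENERATOR TOTAL IN `M` — the case split sits at the term set and nowhere else: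
* `terms₀ L M Z := if M = 0 then ∅ else terms L M Z` — print's term set extended by the EMPTY set at the degenerate cube size `M = 0` (no `M`-cubes, no
  terms; subscript `₀` = «total in `M`, the degenerate value included», NOT «of record»); `terms₀_eq : terms₀ L M Z = terms L M Z` under `[NeZero M]`;
* `StepGen.ofTerms₀ L T`, `GenTower.ofTerms₀ L T`, `TermData214.Gn₀ 𝔇` — g6's ∕ g7's constructions VERBATIM with `terms₀` for `terms` (same index
  type, same generic term; `reducible` as g6's), typed WITHOUT `[NeZero M]`;
* THE FACES under `[NeZero M]`: **`ofTerms₀_eq : StepGen.ofTerms₀ L T = StepGen.ofTerms L T`**, **`GenTower.ofTerms₀_eq`**, **`TermData214.Gn₀_eq :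
  𝔇.Gn₀ = 𝔇.Gn`** (the identification hypothesis of the Summit-side readings, now a theorem), and through them every g6 ∕ g7 statement (`ofTerms₀_H` —
  the activity is print's term sum (2.9)∕(2.11); `mem_idx_ofTerms₀_iff`, `forall_mem_idx_ofTerms₀_iff`, `snd_mem_terms_of_mem_idx₀`, `injOn_snd_idx₀` —
  the index maps of the Summit-side per-term schemas at `e := fun _ i => i.2`; `recTerm_ofTerms₀` ∕ `recTerm_ofTerms₀_succ` ∕ `TermData214.recTerm_Gn₀` ∕
  `recTerm_Gn₀_succ_sum` — the W1 recursion (2.13) with print's term sum, the older terms the generated ones);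
* HONESTY AT `M = 0` (located, by design): the index sets are empty (`ofTerms₀_idx_of_eq_zero`), every activity vanishes (`ofTerms₀_H_of_eq_zero`), every
  (2.13) vanishes (`ofTerms₀_E_of_eq_zero`, read off g2's termless step) and EVERY GENERATED TERM vanishes at every level and every complex history
  (`recTerm_ofTerms₀_of_eq_zero`, `TermData214.recTerm_Gn₀_of_eq_zero`) — the degenerate value is junk carrying no content, exactly as g6's zero
  term functional (`recTerm_ofTerms_zero`).

CONSUMER RECIPE (Summits side; NOT this module — Literature does not import Summits; kernel-checked before filing in a scratch against the binder shapes
of the N22 readings as landed): for a θ-keyed family of term data `𝔇 F θ k : TermDatum214 c (F.P k) (MatA N) θ.M k L` over ALL parameter records `θ`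
(no positivity instance in scope), DEFINE the generator tower of the reading `Gn F θ := TermData214.Gn₀ (fun k => 𝔇 F θ k)` (equivalently
`fun k => StepGen.ofTerms₀ L (𝔇 F θ k).TF`, `Gn₀_apply`); inside the per-`θ` statement, where `NeZero θ.M` is a hypothesis, the identification binder
`hGn : Gn F θ = TermData214.Gn (fun k => 𝔇 F θ k)` is `TermData214.Gn₀_eq _` (per level `TermData214.Gn₀_apply_eq _ k`, at a bare term-functional
family `GenTower.ofTerms₀_eq L TF` ∕ `ofTerms₀_eq L (TF k)`), and every g6 ∕ g7 face is available after `rw [TermData214.Gn₀_eq]` or directly in the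
`₀` spelling above.

HONEST FRAMING: definitions + kernel bookkeeping (one `dite` on `M = 0`, `rfl`, `dif_pos` ∕ `dif_neg`, `funext`, rewriting, `Finset.map_empty` ∕
`Finset.sum_empty`, one vanishing read off g2's termless step); NO estimate; nothing of Bałaban's asserted or constructed; the term functional ∕ datum is
DATA (no law); N22 ∕ N18 ∕ N10 NOT discharged; K3⁗ untouched; counts unmoved; one finite 𝕋⁴ programme at fixed ε, Bałaban as printed — NOT continuum ∕
ℝ⁴ ∕ infinite volume ∕ OS ∕ mass gap ∕ Clay.  No `sorry`, no `axiom`, no `instance`, no `notation`.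

References (TYPES and page anchors only): [II] (2.1)–(2.3) p.12, (2.9)–(2.14) pp.14–15; [I] (0.23) p.256, (2.12)–(2.13) p.268.
-/

open scoped BigOperators

noncomputable section

namespace Literature.MathematicalPhysics.QuantumFieldTheory.Balaban1983to89.Node00

open Literature.MathematicalPhysics.QuantumFieldTheory.Balaban1983to89
open Step B14.Eq213MaximalDomains TreeLengthTorus T4Continuum Sect2
open Literature.MathematicalPhysics.QuantumFieldTheory.Balaban1983to89.TreeLengthTorusGeometry (tgeometry)
open Literature.MathematicalPhysics.QuantumFieldTheory.Balaban1983to89.B13Lemma3TorusData (TBond)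
open Literature.MathematicalPhysics.QuantumFieldTheory.Balaban1983to89.B13Lemma3TorusTerms (terms IsTerm mem_terms)

namespace W1

/-! ## §1  Print's term set made total in the cube size `M` -/

section Terms0

variable {d : ℕ} (L : ℕ) [NeZero L] {N' : ℕ} [NeZero N'] (M : ℕ)

/-- **PRINT'S TERM SET, TOTAL IN THE CUBE SIZE `M`**: the finite set of the terms `(𝐃, P)` of `H(Z)` (`B13Lemma3TorusTerms.terms L M Z`, the index set
of the sums (2.9), (2.1), (2.3)) for a positive cube size, and the EMPTY set at the degenerate value `M = 0` (no `M`-cubes, no terms).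
[cite: Balaban1988RG2Cluster, (2.1)-(2.3) p.12 and (2.9) p.14] -/
def terms₀ (Z : TDom d N') : Finset (Finset (TDom d (L * N')) × Finset (TBond d M (L * N'))) :=
  if h : M = 0 then ∅ else (haveI : NeZero M := ⟨h⟩; terms L M Z)

/-- **FACE: AT A POSITIVE CUBE SIZE THE TOTAL TERM SET IS PRINT'S** (`dif_neg`; `NeZero` is proof-irrelevant). [cite: Balaban1988RG2Cluster, (2.9) p.14 and (2.14) p.15] -/
theorem terms₀_eq [NeZero M] (Z : TDom d N') : terms₀ L M Z = terms L M Z := by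
  unfold terms₀
  rw [dif_neg (NeZero.ne M)]

/-- At the degenerate cube size `M = 0` the total term set is empty (`dif_pos`). [cite: Balaban1988RG2Cluster, (2.1)-(2.3) p.12 (bookkeeping; the degenerate value)] -/
theorem terms₀_of_eq_zero (h : M = 0) (Z : TDom d N') : terms₀ L M Z = ∅ := by
  unfold terms₀
  rw [dif_pos h]

/-- Membership in the total term set at a positive cube size is print's `IsTerm` ((2.1), (2.3), (2.9): `P` avoids the inside of `Y₀`, `Z₀ ≠ ∅`,
`Z′₀ ⊆ Z`). [cite: Balaban1988RG2Cluster, (2.1)-(2.3) p.12 and (2.9) p.14] -/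
theorem mem_terms₀ [NeZero M] {Z : TDom d N'} {t : Finset (TDom d (L * N')) × Finset (TBond d M (L * N'))} :
    t ∈ terms₀ L M Z ↔ IsTerm L M Z t := by
  rw [terms₀_eq]
  exact mem_terms

/-- At the degenerate cube size nothing is a term. [cite: Balaban1988RG2Cluster, (2.1)-(2.3) p.12 (bookkeeping; the degenerate value)] -/
theorem not_mem_terms₀_of_eq_zero (h : M = 0) (Z : TDom d N') (t : Finset (TDom d (L * N')) × Finset (TBond d M (L * N'))) :
    t ∉ terms₀ L M Z := by
  rw [terms₀_of_eq_zero L M h Z]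
  simp

end Terms0

/-! ## §2  The one-step generator in print's term index, total in `M` -/

section OfTerms0

variable {P : Params} {𝔸 : Type*} {M : ℕ} {k : ℕ} (L : ℕ) [NeZero L]

/-- **THE ONE-STEP GENERATOR IN PRINT'S TERM INDEX, TOTAL IN THE CUBE SIZE `M`**: g6's `StepGen.ofTerms` VERBATIM with the total term set — indices at
`Z` = the pairs `(Z, t)`, `t ∈ terms₀ L M Z`; generic term = the term functional; `reducible` (the index type unfolds to the pairs for consumers'
`e := fun _ i => i.2`).  Equal to `StepGen.ofTerms L T` at a positive cube size (`ofTerms₀_eq`); empty index sets at `M = 0`.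
[cite: Balaban1988RG2Cluster, (2.9)-(2.11) p.14 and (2.14) p.15] -/
@[reducible] def StepGen.ofTerms₀ (T : TermFun P 𝔸 M k L) : StepGen P 𝔸 M k where
  Idx := (domSys P M (k + 1)).Dom × TermLabel P M k L
  idx Z := (terms₀ L M Z).map (Function.Embedding.sectR Z (TermLabel P M k L))
  T i := T i.1 i.2

/-- Face: the generic term of the total term-indexed generator (`rfl`). [cite: Balaban1988RG2Cluster, (2.14) p.15 (bookkeeping)] -/
@[simp] theorem ofTerms₀_T (T : TermFun P 𝔸 M k L) (i : (StepGen.ofTerms₀ L T).Idx) (t : ℂ) (old : OlderTerms P 𝔸 M k) (φ : CPair P 𝔸) :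
    (StepGen.ofTerms₀ L T).T i t old φ = T i.1 i.2 t old φ := rfl

/-- Face: the indices localizing at `Z` are `{Z} × terms₀ L M Z` (`rfl`). [cite: Balaban1988RG2Cluster, (2.10) p.14 (bookkeeping)] -/
theorem ofTerms₀_idx (T : TermFun P 𝔸 M k L) (Z : (domSys P M (k + 1)).Dom) :
    (StepGen.ofTerms₀ L T).idx Z = (terms₀ L M Z).map (Function.Embedding.sectR Z (TermLabel P M k L)) := rfl

/-- **FACE: AT A POSITIVE CUBE SIZE THE TOTAL TERM-INDEXED GENERATOR IS g6's** — `StepGen.ofTerms₀ L T = StepGen.ofTerms L T` (same index type, same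
generic term, index sets equal by `terms₀_eq`).  The identification hypothesis of the Summit-side readings of record, as a theorem.
[cite: Balaban1988RG2Cluster, (2.9)-(2.11) p.14 and (2.14) p.15] -/
theorem ofTerms₀_eq [NeZero M] (T : TermFun P 𝔸 M k L) : StepGen.ofTerms₀ L T = StepGen.ofTerms L T := by
  unfold StepGen.ofTerms₀ StepGen.ofTerms
  congr 1
  funext Z
  rw [terms₀_eq]

/-- The indices at `Z` of the total generator are g6's at a positive cube size. [cite: Balaban1988RG2Cluster, (2.10) p.14 (bookkeeping)] -/
theorem idx_ofTerms₀ [NeZero M] (T : TermFun P 𝔸 M k L) (Z : (domSys P M (k + 1)).Dom) :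
    (StepGen.ofTerms₀ L T).idx Z = (StepGen.ofTerms L T).idx Z := by
  rw [ofTerms₀_idx, ofTerms_idx, terms₀_eq]

/-- Membership in the indices at `Z` (positive cube size): first component `Z`, second a term of `Z`. [cite: Balaban1988RG2Cluster, (2.9)-(2.10) p.14 (bookkeeping)] -/
theorem mem_idx_ofTerms₀_iff [NeZero M] (T : TermFun P 𝔸 M k L) {Z : (domSys P M (k + 1)).Dom} {i : (StepGen.ofTerms₀ L T).Idx} :
    i ∈ (StepGen.ofTerms₀ L T).idx Z ↔ i.1 = Z ∧ i.2 ∈ terms L M Z := by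
  rw [idx_ofTerms₀]
  exact mem_idx_ofTerms_iff L T

/-- A statement over the indices at `Z` is the statement over print's terms of `Z` (positive cube size). [cite: Balaban1988RG2Cluster, (2.9)-(2.10) p.14 (bookkeeping)] -/
theorem forall_mem_idx_ofTerms₀_iff [NeZero M] (T : TermFun P 𝔸 M k L) (Z : (domSys P M (k + 1)).Dom) {Q : (StepGen.ofTerms₀ L T).Idx → Prop} :
    (∀ i ∈ (StepGen.ofTerms₀ L T).idx Z, Q i) ↔ ∀ t ∈ terms L M Z, Q (Z, t) := by
  rw [idx_ofTerms₀]
  exact forall_mem_idx_ofTerms_iff L T Z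

/-- **THE INDEX MAP `i ↦ i.2` LANDS IN PRINT'S TERM SET** (positive cube size; the Summit-side per-term schemas' `he` at `e := fun _ i => i.2`).
[cite: Balaban1988RG2Cluster, (2.9) p.14 and (2.14) p.15] -/
theorem snd_mem_terms_of_mem_idx₀ [NeZero M] (T : TermFun P 𝔸 M k L) (Z : (domSys P M (k + 1)).Dom) {i : (StepGen.ofTerms₀ L T).Idx}
    (h : i ∈ (StepGen.ofTerms₀ L T).idx Z) : i.2 ∈ terms L M Z :=
  ((mem_idx_ofTerms₀_iff L T).1 h).2

/-- The indices at `Z` have first component `Z` (positive cube size). [cite: Balaban1988RG2Cluster, (2.10) p.14 (bookkeeping)] -/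
theorem fst_eq_of_mem_idx₀ [NeZero M] (T : TermFun P 𝔸 M k L) (Z : (domSys P M (k + 1)).Dom) {i : (StepGen.ofTerms₀ L T).Idx}
    (h : i ∈ (StepGen.ofTerms₀ L T).idx Z) : i.1 = Z :=
  ((mem_idx_ofTerms₀_iff L T).1 h).1

/-- **THE INDEX MAP `i ↦ i.2` IS INJECTIVE ON THE INDICES AT `Z`** (positive cube size; the Summit-side per-term schemas' `hinj` at `e := fun _ i => i.2`).
[cite: Balaban1988RG2Cluster, (2.9) p.14 and (2.14) p.15] -/
theorem injOn_snd_idx₀ [NeZero M] (T : TermFun P 𝔸 M k L) (Z : (domSys P M (k + 1)).Dom) :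
    Set.InjOn (fun i : (StepGen.ofTerms₀ L T).Idx => i.2) ↑((StepGen.ofTerms₀ L T).idx Z) := by
  intro i hi j hj hij
  exact Prod.ext ((fst_eq_of_mem_idx₀ L T Z hi).trans (fst_eq_of_mem_idx₀ L T Z hj).symm) hij

/-- **THE ACTIVITY IS THE SUM OVER PRINT'S TERMS** (positive cube size): `H(Z)(g_k, old, φ) = Σ_{(𝐃,P) ∈ terms L M Z} T Z (𝐃,P) g_k old φ` —
(2.9)∕(2.11) with the index set of print. [cite: Balaban1988RG2Cluster, (2.9)-(2.11) p.14] -/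
theorem ofTerms₀_H [NeZero M] (T : TermFun P 𝔸 M k L) (t : ℂ) (old : OlderTerms P 𝔸 M k) (φ : CPair P 𝔸) (Z : (domSys P M (k + 1)).Dom) :
    (StepGen.ofTerms₀ L T).H t old φ Z = ∑ s ∈ terms L M Z, T Z s t old φ := by
  rw [ofTerms₀_eq]
  exact ofTerms_H L T t old φ Z

/-- The activity of the total generator is g6's at a positive cube size. [cite: Balaban1988RG2Cluster, (2.9)-(2.11) p.14 (bookkeeping)] -/
theorem H_ofTerms₀ [NeZero M] (T : TermFun P 𝔸 M k L) (t : ℂ) (old : OlderTerms P 𝔸 M k) (φ : CPair P 𝔸) (Z : (domSys P M (k + 1)).Dom) :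
    (StepGen.ofTerms₀ L T).H t old φ Z = (StepGen.ofTerms L T).H t old φ Z := by
  rw [ofTerms₀_eq]

/-- (2.13) of the total generator is g6's at a positive cube size. [cite: Balaban1988RG2Cluster, (2.13) p.14 (bookkeeping)] -/
theorem E_ofTerms₀ [NeZero M] (T : TermFun P 𝔸 M k L) (t : ℂ) (old : OlderTerms P 𝔸 M k) (φ : CPair P 𝔸) (X : (domSys P M (k + 1)).Dom) :
    (StepGen.ofTerms₀ L T).E t old φ X = (StepGen.ofTerms L T).E t old φ X := by
  rw [ofTerms₀_eq]

/-- **DOMINATION BY THE TERM SUM** (positive cube size; the triangle inequality): `‖H(Z)‖ ≤ Σ_{t ∈ terms L M Z} ‖T Z t …‖`.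
[cite: Balaban1988RG2Cluster, (2.9) p.14 and (2.26) p.17] -/
theorem norm_H_ofTerms₀_le [NeZero M] (T : TermFun P 𝔸 M k L) (t : ℂ) (old : OlderTerms P 𝔸 M k) (φ : CPair P 𝔸) (Z : (domSys P M (k + 1)).Dom) :
    ‖(StepGen.ofTerms₀ L T).H t old φ Z‖ ≤ ∑ s ∈ terms L M Z, ‖T Z s t old φ‖ := by
  rw [ofTerms₀_eq]
  exact norm_H_ofTerms_le L T t old φ Z

/-- HONESTY AT THE DEGENERATE CUBE SIZE: at `M = 0` the index sets are empty. [cite: Balaban1988RG2Cluster, (2.10) p.14 (bookkeeping; the degenerate value)] -/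
theorem ofTerms₀_idx_of_eq_zero (h : M = 0) (T : TermFun P 𝔸 M k L) (Z : (domSys P M (k + 1)).Dom) :
    (StepGen.ofTerms₀ L T).idx Z = ∅ := by
  rw [ofTerms₀_idx, terms₀_of_eq_zero L M h, Finset.map_empty]

/-- HONESTY AT THE DEGENERATE CUBE SIZE: at `M = 0` every activity vanishes (an empty (2.11) sum). [cite: Balaban1988RG2Cluster, (2.11) p.14 (bookkeeping; the degenerate value)] -/
theorem ofTerms₀_H_of_eq_zero (h : M = 0) (T : TermFun P 𝔸 M k L) (t : ℂ) (old : OlderTerms P 𝔸 M k) (φ : CPair P 𝔸)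
    (Z : (domSys P M (k + 1)).Dom) : (StepGen.ofTerms₀ L T).H t old φ Z = 0 := by
  show ∑ i ∈ (StepGen.ofTerms₀ L T).idx Z, (StepGen.ofTerms₀ L T).T i t old φ = 0
  rw [ofTerms₀_idx_of_eq_zero L h, Finset.sum_empty]

open Classical in
/-- HONESTY AT THE DEGENERATE CUBE SIZE: at `M = 0` every (2.13) vanishes (read off g2's termless step: the Kotecký–Preiss literal of the zero activity
is `0`). [cite: Balaban1988RG2Cluster, (2.13) p.14 (bookkeeping; the degenerate value)] -/
theorem ofTerms₀_E_of_eq_zero (h : M = 0) (T : TermFun P 𝔸 M k L) (t : ℂ) (old : OlderTerms P 𝔸 M k) (φ : CPair P 𝔸)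
    (X : (domSys P M (k + 1)).Dom) : (StepGen.ofTerms₀ L T).E t old φ X = 0 := by
  have h0 := E_termlessTower (P := P) (𝔸 := 𝔸) (M := M) k (fun _ => 0) φ X
  rw [ClusterStep.E_eq_locE] at h0
  refine Eq.trans ?_ h0
  unfold StepGen.E
  exact B13Resummation.locE_congr _ fun Z _ => by rw [ofTerms₀_H_of_eq_zero L h, H_termlessTower]

end OfTerms0

/-! ## §3  Towers, total in `M`: the generated history with print's term sums, and its vanishing at the degenerate cube size -/

section Towers0

variable {P : Params} {𝔸 : Type*} {M : ℕ} (L : ℕ) [NeZero L]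

/-- **THE GENERATOR TOWER OF A TERM-FUNCTIONAL FAMILY, TOTAL IN THE CUBE SIZE `M`** (step-wise `StepGen.ofTerms₀`; `= GenTower.ofTerms L T` at a
positive cube size). [cite: Balaban1987RG1, (2.12)-(2.13) p.268; Balaban1988RG2Cluster, (2.14) p.15] -/
def GenTower.ofTerms₀ (T : GenTermFun P 𝔸 M L) : GenTower P 𝔸 M := fun k => StepGen.ofTerms₀ L (T k)

/-- Face (`rfl`). [cite: Balaban1987RG1, (2.12)-(2.13) p.268 (bookkeeping)] -/
@[simp] theorem GenTower.ofTerms₀_apply (T : GenTermFun P 𝔸 M L) (k : ℕ) : GenTower.ofTerms₀ L T k = StepGen.ofTerms₀ L (T k) := rfl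

/-- **FACE: AT A POSITIVE CUBE SIZE THE TOTAL GENERATOR TOWER IS g6's** — `GenTower.ofTerms₀ L T = GenTower.ofTerms L T`.
[cite: Balaban1987RG1, (2.12)-(2.13) p.268; Balaban1988RG2Cluster, (2.14) p.15] -/
theorem GenTower.ofTerms₀_eq [NeZero M] (T : GenTermFun P 𝔸 M L) : GenTower.ofTerms₀ L T = GenTower.ofTerms L T :=
  funext fun k => W1.ofTerms₀_eq L (T k)

/-- The generated terms of the total tower are g6's at a positive cube size, at every level and every complex history.
[cite: Balaban1987RG1, (0.23) p.256 and (2.12)-(2.13) p.268; Balaban1988RG2Cluster, (2.13) p.14] -/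
theorem recTerm_ofTerms₀ [NeZero M] (T : GenTermFun P 𝔸 M L) (g : ℕ → ℂ) (j : ℕ) (X : (domSys P M j).Dom) (φ : CPair P 𝔸) :
    recTerm (GenTower.ofTerms₀ L T) g j X φ = recTerm (GenTower.ofTerms L T) g j X φ := by
  rw [GenTower.ofTerms₀_eq]

/-- The real reading of the total tower is g6's at a positive cube size. [cite: Balaban1988RG2Cluster, (2.14) p.15; Balaban1987RG1, (2.13) p.268 (bookkeeping)] -/
theorem toClusterTower_ofTerms₀ [NeZero M] (T : GenTermFun P 𝔸 M L) :
    toClusterTower (GenTower.ofTerms₀ L T) = toClusterTower (GenTower.ofTerms L T) := by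
  rw [GenTower.ofTerms₀_eq]

open Classical in
/-- **THE W1 RECURSION WITH PRINT'S TERM SUM, FROM THE TOTAL TOWER** (positive cube size) — (2.13) at step `k + 1` literally:
`E^{(k+1)}(X; g; φ) = locE (Z ↦ Σ_{(𝐃,P) ∈ terms L M Z} T k Z (𝐃,P) g_k (E^{(j)}(g))_{j≤k} φ) X`, the older terms the GENERATED ones.
[cite: Balaban1988RG2Cluster, (2.13)-(2.14) pp.14-15; Balaban1987RG1, (2.12)-(2.13) p.268] -/
theorem recTerm_ofTerms₀_succ [NeZero M] (T : GenTermFun P 𝔸 M L) (g : ℕ → ℂ) (k : ℕ) (X : (domSys P M (k + 1)).Dom) (φ : CPair P 𝔸) :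
    recTerm (GenTower.ofTerms₀ L T) g (k + 1) X φ =
      B13Resummation.locE (tgeometry P.d (domCount P M (k + 1))).ι (tgeometry P.d (domCount P M (k + 1))).cubes
        (fun Z => ∑ s ∈ terms L M Z, T k Z s (g k) (olderOf (recTerm (GenTower.ofTerms₀ L T) g) k) φ) (Subtype.val X) := by
  rw [GenTower.ofTerms₀_eq]
  exact recTerm_ofTerms_succ L T g k X φ

/-- **HONESTY AT THE DEGENERATE CUBE SIZE — EVERYTHING GENERATED VANISHES**: at `M = 0` EVERY GENERATED TERM `E^{(j)}(X; g; φ)` of the total tower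
vanishes, at every level and every complex history (the degenerate value is junk by design; the content lives at the cube size of record).
[cite: Balaban1987RG1, (0.23) p.256 and (2.13) p.268; Balaban1988RG2Cluster, (2.13)-(2.14) pp.14-15] -/
theorem recTerm_ofTerms₀_of_eq_zero (h : M = 0) (T : GenTermFun P 𝔸 M L) (g : ℕ → ℂ) :
    ∀ (j : ℕ) (X : (domSys P M j).Dom) (φ : CPair P 𝔸), recTerm (GenTower.ofTerms₀ L T) g j X φ = 0
  | 0, X, φ => by simp
  | k + 1, X, φ => by
    rw [recTerm_succ, GenTower.ofTerms₀_apply]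
    exact ofTerms₀_E_of_eq_zero L h (k := k) (T k) (g k) _ φ X

/-- At `M = 0` the real reading of the total tower has vanishing terms at every real history. [cite: Balaban1987RG1, (0.23) p.256 and (2.13) p.268 (bookkeeping)] -/
theorem termC_toClusterTower_ofTerms₀_of_eq_zero (h : M = 0) (T : GenTermFun P 𝔸 M L) (g : ℕ → ℝ) (j : ℕ) (X : (domSys P M j).Dom)
    (φ : CPair P 𝔸) : termC (toClusterTower (GenTower.ofTerms₀ L T)) j X g φ = 0 := by
  rw [termC_toClusterTower]
  exact recTerm_ofTerms₀_of_eq_zero L h T _ j X φ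

end Towers0

/-! ## §4  The generator tower of a (2.14) term-datum family, total in `M` -/

namespace TermData214

variable {c : B13.Consts} {P : Params} {𝔸 : Type*} {M L : ℕ} [NeZero L] (𝔇 : TermData214 c P 𝔸 M L)

/-- **THE GENERATOR TOWER OF A TERM-DATUM FAMILY, TOTAL IN THE CUBE SIZE `M`**: the total term-indexed generator tower at the generated term
functionals — indices at `Z` = the pairs `(Z, t)`, `t ∈ terms₀ L M Z`, generic term = (2.14) of the datum; typed WITHOUT a positivity instance on `M`
and equal to g7's `TermData214.Gn` at a positive cube size (`Gn₀_eq`). [cite: Balaban1988RG2Cluster, (2.9)-(2.11) p.14 and (2.14) p.15; Balaban1987RG1, (2.12)-(2.13) p.268] -/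
def Gn₀ : GenTower P 𝔸 M := GenTower.ofTerms₀ L 𝔇.TF

/-- Face: `𝔇.Gn₀ = GenTower.ofTerms₀ L 𝔇.TF` (`rfl`). [cite: Balaban1988RG2Cluster, (2.14) p.15 (bookkeeping)] -/
theorem Gn₀_eq_ofTerms₀ : 𝔇.Gn₀ = GenTower.ofTerms₀ L 𝔇.TF := rfl

/-- Face: the step-`k` generator of the total tower (`rfl`). [cite: Balaban1988RG2Cluster, (2.14) p.15 (bookkeeping)] -/
@[simp] theorem Gn₀_apply (k : ℕ) : 𝔇.Gn₀ (L := L) k = StepGen.ofTerms₀ L (𝔇 k).TF := rfl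

/-- **FACE: AT A POSITIVE CUBE SIZE THE TOTAL GENERATOR TOWER OF THE DATUM IS g7's** — `𝔇.Gn₀ = 𝔇.Gn`: the identification hypothesis
`Gn = 𝔇.Gn` of the Summit-side readings of record at `Gn := 𝔇.Gn₀`, as a theorem. [cite: Balaban1988RG2Cluster, (2.9)-(2.11) p.14 and (2.14) p.15; Balaban1987RG1, (2.12)-(2.13) p.268] -/
theorem Gn₀_eq [NeZero M] : 𝔇.Gn₀ (L := L) = 𝔇.Gn := GenTower.ofTerms₀_eq L 𝔇.TF

/-- The same per level. [cite: Balaban1988RG2Cluster, (2.14) p.15 (bookkeeping)] -/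
theorem Gn₀_apply_eq [NeZero M] (k : ℕ) : 𝔇.Gn₀ (L := L) k = 𝔇.Gn k := ofTerms₀_eq L (𝔇 k).TF

/-- At a positive cube size the total tower is g6's term-indexed tower of the datum's term functionals. [cite: Balaban1988RG2Cluster, (2.14) p.15 (bookkeeping)] -/
theorem Gn₀_eq_ofTerms [NeZero M] : 𝔇.Gn₀ (L := L) = GenTower.ofTerms L 𝔇.TF := GenTower.ofTerms₀_eq L 𝔇.TF

/-- **THE ACTIVITY (2.11) OF THE DATUM'S TOTAL GENERATOR** (positive cube size): `H(Z) = Σ_{(𝐃,P) ∈ terms L M Z} (2.14)_{(𝐃,P)}(Z)(g_k, old, φ)`.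
[cite: Balaban1988RG2Cluster, (2.9)-(2.11) p.14 and (2.14) p.15] -/
theorem H_Gn₀ [NeZero M] (k : ℕ) (s : ℂ) (old : OlderTerms P 𝔸 M k) (φ : CPair P 𝔸) (Z : (domSys P M (k + 1)).Dom) :
    (𝔇.Gn₀ (L := L) k).H s old φ Z = ∑ t ∈ terms L M Z, (𝔇 k).TF Z t s old φ := by
  rw [Gn₀_apply]
  exact ofTerms₀_H L (𝔇 k).TF s old φ Z

/-- The activities of the total tower are g7's at a positive cube size. [cite: Balaban1988RG2Cluster, (2.9)-(2.11) p.14 (bookkeeping)] -/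
theorem H_Gn₀_eq [NeZero M] (k : ℕ) (s : ℂ) (old : OlderTerms P 𝔸 M k) (φ : CPair P 𝔸) (Z : (domSys P M (k + 1)).Dom) :
    (𝔇.Gn₀ (L := L) k).H s old φ Z = (𝔇.Gn (L := L) k).H s old φ Z := by
  rw [Gn₀_eq]

/-- The activity of the datum's total generator is dominated by the sum of the norms of its (2.14) terms (positive cube size).
[cite: Balaban1988RG2Cluster, (2.9)-(2.11) p.14 and (2.26) p.17] -/
theorem norm_H_Gn₀_le [NeZero M] (k : ℕ) (s : ℂ) (old : OlderTerms P 𝔸 M k) (φ : CPair P 𝔸) (Z : (domSys P M (k + 1)).Dom) :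
    ‖(𝔇.Gn₀ (L := L) k).H s old φ Z‖ ≤ ∑ t ∈ terms L M Z, ‖(𝔇 k).TF Z t s old φ‖ := by
  rw [Gn₀_apply]
  exact norm_H_ofTerms₀_le L (𝔇 k).TF s old φ Z

/-- The generated terms of the total tower are g7's at a positive cube size, at every level and every complex history.
[cite: Balaban1987RG1, (0.23) p.256 and (2.12)-(2.13) p.268; Balaban1988RG2Cluster, (2.13) p.14] -/
theorem recTerm_Gn₀ [NeZero M] (g : ℕ → ℂ) (j : ℕ) (X : (domSys P M j).Dom) (φ : CPair P 𝔸) :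
    recTerm (𝔇.Gn₀ (L := L)) g j X φ = recTerm (𝔇.Gn (L := L)) g j X φ := by
  rw [Gn₀_eq]

/-- The real reading of the total tower is g7's at a positive cube size. [cite: Balaban1988RG2Cluster, (2.14) p.15; Balaban1987RG1, (2.13) p.268 (bookkeeping)] -/
theorem toClusterTower_Gn₀ [NeZero M] : toClusterTower (𝔇.Gn₀ (L := L)) = toClusterTower (𝔇.Gn (L := L)) := by
  rw [Gn₀_eq]

open Classical in
/-- **THE W1 RECURSION (2.13) WITH THE (2.14) TERMS OF THE DATUM, FROM THE TOTAL TOWER** (positive cube size):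
`E^{(k+1)}(X; g) = locE (Z ↦ Σ_{t ∈ terms L M Z} (𝔇 k).TF Z t g_k (E^{(j)}(g))_{j≤k} φ) X`, the older terms entering each (2.14) term through the
potentials `𝐕_k` (`recTerm_ofTerms_succ` by name). [cite: Balaban1987RG1, (2.12)-(2.13) p.268; Balaban1988RG2Cluster, (2.13)-(2.14) pp.14-15] -/
theorem recTerm_Gn₀_succ_sum [NeZero M] (g : ℕ → ℂ) (k : ℕ) (X : (domSys P M (k + 1)).Dom) (φ : CPair P 𝔸) :
    recTerm (𝔇.Gn₀ (L := L)) g (k + 1) X φ =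
      B13Resummation.locE (tgeometry P.d (domCount P M (k + 1))).ι (tgeometry P.d (domCount P M (k + 1))).cubes
        (fun Z => ∑ t ∈ terms L M Z, (𝔇 k).TF Z t (g k) (olderOf (recTerm (𝔇.Gn₀ (L := L)) g) k) φ) (Subtype.val X) := by
  rw [Gn₀_eq]
  exact 𝔇.recTerm_Gn_succ_sum g k X φ

/-- HONESTY AT THE DEGENERATE CUBE SIZE: at `M = 0` every activity of the datum's total generator vanishes.
[cite: Balaban1988RG2Cluster, (2.11) p.14 (bookkeeping; the degenerate value)] -/
theorem H_Gn₀_of_eq_zero (h : M = 0) (k : ℕ) (s : ℂ) (old : OlderTerms P 𝔸 M k) (φ : CPair P 𝔸) (Z : (domSys P M (k + 1)).Dom) :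
    (𝔇.Gn₀ (L := L) k).H s old φ Z = 0 := by
  rw [Gn₀_apply]
  exact ofTerms₀_H_of_eq_zero L h (𝔇 k).TF s old φ Z

/-- **HONESTY AT THE DEGENERATE CUBE SIZE**: at `M = 0` EVERY GENERATED TERM of the datum's total tower vanishes, at every level and every complex
history — the degenerate value of the total tower is junk by design; (S-loc)∕(S-226)∕(S-last) are properties of the datum OF RECORD at its positive
cube size. [cite: Balaban1987RG1, (0.23) p.256 and (2.13) p.268; Balaban1988RG2Cluster, (2.13)-(2.14) pp.14-15] -/
theorem recTerm_Gn₀_of_eq_zero (h : M = 0) (g : ℕ → ℂ) (j : ℕ) (X : (domSys P M j).Dom) (φ : CPair P 𝔸) :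
    recTerm (𝔇.Gn₀ (L := L)) g j X φ = 0 :=
  recTerm_ofTerms₀_of_eq_zero L h 𝔇.TF g j X φ

end TermData214

end W1

end Literature.MathematicalPhysics.QuantumFieldTheory.Balaban1983to89.Node00
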